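import Summits.PneNP.PneNP.Theorems.PairwiseSALinear
import Summits.PneNP.PneNP.Theorems.PstarSASDPLevel

/-!
# Towards T23.3: pair laws of the `k`-ary reweighted Sherali–Adams family factor (biased BGMT Claim 3.4, general arity) — cell `pnp-ideate`

FRONTIER range-avoidance ladder, rung F-N3 context (restricted-model lower bound for the mixed Sherali–Adams + SDP hierarchy,
`PstarSASDPLevel.SASDPFeasible`); nothing here bears on `P` vs `NP`.

The `k`-ary, law-abstract form of `PstarSASDPPairs` for the laws `PairwiseSA.law I p μ` of a biased pairwise-independent law system
(`PairwiseSALevel.PairwiseLaws`):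

* the bias-product law `W I p μ ∅` has product cylinder masses (`cyl_W_empty`), so its singleton / pair pseudo-marginals are `p v` and
  `p v · p w` (`single_W_empty`, `pair_W_empty`); sets of fewer than `k` variables dominate no output (`dom_eq_empty_of_card_lt`);
* **expansion off at most two variables** (`expandingOff_of_card_le_two`, BGMT Claim 3.4's expansion step): with injective slots, simple
  overlaps and `(r, a/b)`-boundary expansion at a ratio `a/b > k − 3 + 2/3` (`(3k−7)·b < 3a`), every family of `≤ r` outputs is
  expanding off any `T` with `#T ≤ 2` — singletons have `k` boundary variables, pairs at least `2k − 2` (`card_bdry_pair_ge`), and from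
  three members on the ratio absorbs the two removed variables.
-/

set_option linter.dupNamespace false

open Finset Literature.Computability.Complexity
open Summit.PneNP.PneNP.Theorems.PstarPairwise (rho)
open Summit.PneNP.PneNP.Theorems.PstarSALevel (cyl varSet bdry SimpleOverlap)
open Summit.PneNP.PneNP.Theorems.PstarSASDPLevel (BoundaryExpandingQ)
open Summit.PneNP.PneNP.Theorems.PstarSAPeeling (cylOff mem_cylOff filter_agree_eq_cylOff)
open Summit.PneNP.PneNP.Theorems.PairwiseSALevel (PairwiseLaws card_varSet_of_injective)

namespace Summit.PneNP.PneNP.Theorems.PairwiseSA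

variable {k n m : ℕ}

/-! ## The bias-product law -/

/-- **Cylinder masses of the bias-product law are products of biases.** -/
theorem cyl_W_empty (I : LocalMap k n m) (p : Fin n → ℝ) (μ : Fin m → (Fin k → Bool) → ℝ) (T : Finset (Fin n))
    (a : Fin n → Bool) : cyl (W I p μ ∅) T a = ∏ v ∈ T, rho (p v) (a v) := by
  unfold PstarSALevel.cyl
  rw [filter_agree_eq_cylOff]
  have h : ∀ β ∈ cylOff Tᶜ a, W I p μ ∅ β = (∏ v ∈ T, rho (p v) (a v)) * ∏ v ∈ Tᶜ, rho (p v) (β v) := by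
    intro β hβ
    rw [W_empty, ← prod_mul_prod_compl T]
    congr 1
    exact prod_congr rfl fun v hv => by rw [mem_cylOff.1 hβ v (fun hc => (mem_compl.1 hc) hv)]
  rw [sum_congr rfl h, ← mul_sum, sum_cylOff_prod_rho, mul_one]

/-- The singleton pseudo-marginal of the bias-product law is the bias. -/
theorem single_W_empty (I : LocalMap k n m) (p : Fin n → ℝ) (μ : Fin m → (Fin k → Bool) → ℝ) (v : Fin n) :
    cyl (W I p μ ∅) {v} (fun _ => true) = p v := by
  rw [cyl_W_empty, prod_singleton]
  simp [rho]

/-- The pair pseudo-marginal of the bias-product law is the product of the biases. -/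
theorem pair_W_empty (I : LocalMap k n m) (p : Fin n → ℝ) (μ : Fin m → (Fin k → Bool) → ℝ) {v w : Fin n} (hvw : v ≠ w) :
    cyl (W I p μ ∅) {v, w} (fun _ => true) = p v * p w := by
  rw [cyl_W_empty, prod_pair hvw]
  simp [rho]

/-- Sets of fewer than `k` variables dominate no output (injective slots). -/
theorem dom_eq_empty_of_card_lt {I : LocalMap k n m} (hinj : ∀ j, Function.Injective (I.vars j)) {S : Finset (Fin n)}
    (hS : S.card < k) : dom I S = ∅ := by
  ext j
  simp only [mem_dom, notMem_empty, iff_false]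
  intro h
  have := card_le_card h
  rw [card_varSet_of_injective I (hinj j)] at this
  omega

/-! ## Expansion off at most two variables (BGMT Claim 3.4's expansion step) -/

/-- A variable of `j` not read by `j'` is a boundary variable of `{j, j'}`. -/
theorem mem_bdry_pair_of_mem_sdiff (I : LocalMap k n m) {j j' : Fin m} (hne : j ≠ j') {v : Fin n}
    (hv : v ∈ varSet I j \ varSet I j') : v ∈ bdry I {j, j'} := by
  rw [mem_sdiff] at hv
  unfold PstarSALevel.bdry
  rw [mem_filter, card_eq_one]
  refine ⟨mem_univ _, j, ?_⟩
  ext i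
  simp only [mem_filter, mem_insert, mem_singleton]
  constructor
  · rintro ⟨rfl | rfl, hi⟩
    · rfl
    · exact absurd hi hv.2
  · rintro rfl
    exact ⟨Or.inl rfl, hv.1⟩

/-- **Two outputs with simple overlap have at least `2k − 2` boundary variables.** -/
theorem card_bdry_pair_ge {I : LocalMap k n m} (hinj : ∀ j, Function.Injective (I.vars j)) (hSO : SimpleOverlap I)
    {j j' : Fin m} (hne : j ≠ j') : 2 * k ≤ (bdry I {j, j'}).card + 2 := by
  have hsub : (varSet I j \ varSet I j') ∪ (varSet I j' \ varSet I j) ⊆ bdry I {j, j'} := by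
    intro v hv
    rcases mem_union.1 hv with hv | hv
    · exact mem_bdry_pair_of_mem_sdiff I hne hv
    · rw [pair_comm]
      exact mem_bdry_pair_of_mem_sdiff I hne.symm hv
  have hdisj : Disjoint (varSet I j \ varSet I j') (varSet I j' \ varSet I j) := disjoint_sdiff_sdiff
  have h1 := card_sdiff_add_card_inter (varSet I j) (varSet I j')
  have h2 := card_sdiff_add_card_inter (varSet I j') (varSet I j)
  rw [card_varSet_of_injective I (hinj j)] at h1
  rw [card_varSet_of_injective I (hinj j'), inter_comm] at h2
  have h3 := hSO j j' hne
  have h4 := card_le_card hsub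
  rw [card_union_of_disjoint hdisj] at h4
  omega

/-- **Expansion off at most two variables.**  With injective slots, simple overlaps and `(r, a/b)`-boundary expansion at a ratio with
`(3k−7)·b < 3a`, every family of at most `r` outputs is expanding off any set of at most two variables. -/
theorem expandingOff_of_card_le_two {a b r : ℕ} {I : LocalMap k n m} (hk : 3 ≤ k) (hinj : ∀ j, Function.Injective (I.vars j))
    (hSO : SimpleOverlap I) (hab : (3 * k - 7) * b < 3 * a) (hB : BoundaryExpandingQ a b r I) {T : Finset (Fin n)}
    (hT : T.card ≤ 2) {E : Finset (Fin m)} (hE : E.card ≤ r) : ExpandingOff I T E := by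
  intro J hJ hne
  have hJr : J.card ≤ r := (card_le_card hJ).trans hE
  have hab' := hB J hJr
  have hsd := le_card_sdiff T (bdry I J)
  have hpos := hne.card_pos
  obtain ⟨d, rfl⟩ := Nat.exists_eq_add_of_le hk
  have hd : 3 + d - 3 = d := by omega
  rw [hd]
  rcases Nat.lt_or_ge J.card 3 with h3 | h3
  · rcases Nat.lt_or_ge J.card 2 with h2 | h2
    · -- one output: `k` boundary variables
      obtain ⟨j, rfl⟩ := card_eq_one.1 (show J.card = 1 by omega)
      rw [bdry_singleton] at hsd ⊢
      rw [card_varSet_of_injective I (hinj j)] at hsd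
      rw [card_singleton]
      omega
    · -- two outputs: at least `2k − 2` boundary variables
      obtain ⟨j, j', hjj', rfl⟩ := card_eq_two.1 (show J.card = 2 by omega)
      have h6 := card_bdry_pair_ge hinj hSO hjj'
      rw [card_pair hjj']
      omega
  · -- three or more outputs: the ratio absorbs the two removed variables: `b·(d·s + 2) < a·s`
    have h37 : 3 * (3 + d) - 7 = 3 * d + 2 := by omega
    rw [h37] at hab
    rcases Nat.eq_zero_or_pos b with hb0 | hb
    · subst hb0
      have : a * J.card ≤ 0 := by simpa using hab'
      have ha : 0 < a := by omega
      rw [Nat.le_zero, Nat.mul_eq_zero] at this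
      omega
    · -- `b (d s + 2) < a s ≤ b #bdry`, hence `d s + 2 ≤ #bdry`, so `d s < #bdry − 2 ≤ #(bdry \ T)`
      have h1 : b * (d * J.card + 2) < a * J.card := by
        have h3' : 3 * (b * (d * J.card + 2)) ≤ (3 * d + 2) * b * J.card := by nlinarith
        have h4 : (3 * d + 2) * b * J.card < 3 * a * J.card := Nat.mul_lt_mul_of_pos_right hab hpos
        nlinarith
      have h2 : b * (d * J.card + 2) < b * (bdry I J).card := lt_of_lt_of_le h1 hab'
      have h5 := Nat.lt_of_mul_lt_mul_left h2
      omega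

end Summit.PneNP.PneNP.Theorems.PairwiseSA
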